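import Mathlib
import Summits.KontsevichZagierPeriods.KontsevichZagierPeriods.Theorems.SoloInformedEulerBetaFamily
import HarnessLib
import HarnessLib.Audit

/-!
# SoloInformed — the equianharmonic Euler sectors decided (Theorem IX″)

The hypothesis of Theorem IX′ (`soloInformed_kzp_on_eulerSector`: the Kontsevich–Zagier
conjecture on `ℤ[⟦β(a,½)⟧, ⟦β(a+½,½)⟧, ⟦π⟧]` granted `B(a,½), π` algebraically independent) is
DISCHARGED at `a = ⅓` and `a = ⅙` from Chudnovsky's theorem on `π, Γ(⅓)` (a tree theorem,
`algebraicIndependent_real_pi_gamma_one_third`), via the Γ-evaluations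

  `Γ(⅓)¹⁸ = (256/27) · π⁶ · B(⅓,½)⁶`,   `Γ(⅓)⁹ = (16/27) · π³ · B(⅙,½)³`

(Legendre duplication at `s = ⅓, ⅙`, reflection at `s = ⅓`, `sin²(π/3) = ¾`).  Hence:

**Theorem IX″.** *The Kontsevich–Zagier conjecture holds, unconditionally, on the equianharmonic
sectors `ℤ[⟦β(⅓,½)⟧, ⟦β(⅚,½)⟧, ⟦π⟧]` and `ℤ[⟦β(⅙,½)⟧, ⟦β(⅔,½)⟧, ⟦π⟧]` of the formal period
ring* (`soloInformed_kzp_on_eulerSector_third`, `soloInformed_kzp_on_eulerSector_sixth`); the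
derived quadratic relations are `⟦β(⅓,½)⟧⟦β(⅚,½)⟧ = 3⟦π⟧` and `⟦β(⅙,½)⟧⟦β(⅔,½)⟧ = 6⟦π⟧`
(periods of the CM curves `y² = x³ − 1`, `y² = x⁶ − 1`… in Beta normalisation).
Residency `solo-KontsevichZagierPeriods-informed` (s22); paper §6octies.

References: G. V. Chudnovsky, *Contributions to the theory of transcendental numbers* (1984),
Ch. 7, Cor. 2.3; M. Waldschmidt, *Elliptic functions and transcendence* (2008), Cor. 33;
A. M. Legendre (duplication); Andrews–Askey–Roy (1999), Thm. 1.5.1, (1.8.1).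
-/

noncomputable section

open MeasureTheory Set Filter
namespace Summit.KontsevichZagierPeriods.KontsevichZagierPeriods.Theorems

open Literature.NumberTheory.Transcendental Literature.NumberTheory.Transcendental.KZ
open Literature.ModelTheory.ExponentialFields

/-- `(Γ(⅓) Γ(⅔))² = 4π²/3` (reflection at `⅓`, `sin²(π/3) = ¾`). [Euler] -/
theorem soloInformed_sq_gamma_third_mul_gamma_two_thirds :
    (Real.Gamma (1 / 3) * Real.Gamma (2 / 3)) ^ 2 = 4 * Real.pi ^ 2 / 3 := by
  have e := Real.Gamma_mul_Gamma_one_sub (1 / 3 : ℝ)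
  rw [show (1 : ℝ) - 1 / 3 = 2 / 3 by norm_num, show Real.pi * (1 / 3) = Real.pi / 3 by ring] at e
  rw [e, div_pow, Real.sq_sin_pi_div_three]
  ring

/-- **`Γ(⅓)¹⁸ = (256/27) π⁶ B(⅓,½)⁶`** for a representation pinned as `β(⅓,½)`
(`B(⅓,½) = Γ(⅓)√π/Γ(⅚)`, duplication `Γ(⅓)Γ(⅚) = 2^{1/3}√π Γ(⅔)`, reflection).
[Legendre; Andrews–Askey–Roy 1999, Thm. 1.5.1] -/
theorem soloInformed_gamma_third_pow_eighteen (B : IntegralRep 1)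
    (hBd : B.domain = {t | t 0 ∈ Set.Ioo (0:ℝ) 1})
    (hBi : Set.EqOn B.integrand
      (fun t => (t 0) ^ (((1 / 3 : ℚ) : ℝ) - 1) * (1 - t 0) ^ (((1 / 2 : ℚ) : ℝ) - 1)) B.domain) :
    Real.Gamma (1 / 3) ^ 18 = 256 / 27 * Real.pi ^ 6 * B.value ^ 6 := by
  set g := Real.Gamma (1 / 3) with hg
  set c : ℝ := (2 : ℝ) ^ ((1 : ℝ) / 3) with hc
  have hG56 : Real.Gamma (5 / 6) ≠ 0 := (Real.Gamma_pos_of_pos (by norm_num)).ne'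
  have hc3 : c ^ 3 = 2 := by
    rw [hc, ← Real.rpow_natCast, ← Real.rpow_mul (by norm_num)]
    norm_num
  -- value
  have hv := soloInformed_value_betaRep (1 / 3) (1 / 2) (by norm_num) (by norm_num) B hBd hBi
  have hv' : B.value = g * Real.sqrt Real.pi / Real.Gamma (5 / 6) := by
    rw [hv, ← Real.Gamma_one_half_eq, hg]
    push_cast
    norm_num
  have hBv : B.value * Real.Gamma (5 / 6) = g * Real.sqrt Real.pi := by
    rw [hv']
    exact div_mul_cancel₀ _ hG56
  -- duplication at 1/3 : Γ(1/3) Γ(5/6) = Γ(2/3) c √π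
  have e1 : g * Real.Gamma (5 / 6) = Real.Gamma (2 / 3) * c * Real.sqrt Real.pi := by
    have e := Real.Gamma_mul_Gamma_add_half (1 / 3 : ℝ)
    rw [show (1 : ℝ) / 3 + 1 / 2 = 5 / 6 by norm_num, show (2 : ℝ) * (1 / 3) = 2 / 3 by norm_num,
      show (1 : ℝ) - 2 / 3 = 1 / 3 by norm_num] at e
    rw [hg, hc]
    exact e
  have hsq : (g * Real.Gamma (2 / 3)) ^ 2 = 4 * Real.pi ^ 2 / 3 := by
    rw [hg]
    exact soloInformed_sq_gamma_third_mul_gamma_two_thirds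
  -- B Γ(2/3) c = g²
  have hBc : B.value * Real.Gamma (2 / 3) * c = g ^ 2 := by
    apply mul_right_cancel₀ hG56
    calc B.value * Real.Gamma (2 / 3) * c * Real.Gamma (5 / 6)
        = (B.value * Real.Gamma (5 / 6)) * (Real.Gamma (2 / 3) * c) := by ring
      _ = g * Real.sqrt Real.pi * (Real.Gamma (2 / 3) * c) := by rw [hBv]
      _ = g ^ 2 * Real.Gamma (5 / 6) := by linear_combination (-g) * e1
  have h6 : B.value ^ 2 * c ^ 2 * (4 * Real.pi ^ 2 / 3) = g ^ 6 := by
    rw [← hsq]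
    linear_combination (g ^ 2 * (B.value * Real.Gamma (2 / 3) * c + g ^ 2)) * hBc
  have e : (B.value ^ 2 * c ^ 2 * (4 * Real.pi ^ 2 / 3)) ^ 3 = (g ^ 6) ^ 3 := by rw [h6]
  rw [show (g ^ 6) ^ 3 = g ^ 18 by ring] at e
  rw [show (B.value ^ 2 * c ^ 2 * (4 * Real.pi ^ 2 / 3)) ^ 3 =
      B.value ^ 6 * (c ^ 3) ^ 2 * (64 * Real.pi ^ 6 / 27) by ring, hc3] at e
  linear_combination -e

/-- **`B(⅓,½)` and `π` are algebraically independent over `ℚ`** (Chudnovsky, Beta normalisation: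
`Γ(⅓)¹⁸ ∈ ℚ(B, π)`). [Chudnovsky 1984, Ch. 7, Cor. 2.3; Waldschmidt 2008, Cor. 33] -/
theorem soloInformed_algebraicIndependent_betaThirdHalf_pi (B : IntegralRep 1)
    (hBd : B.domain = {t | t 0 ∈ Set.Ioo (0:ℝ) 1})
    (hBi : Set.EqOn B.integrand
      (fun t => (t 0) ^ (((1 / 3 : ℚ) : ℝ) - 1) * (1 - t 0) ^ (((1 / 2 : ℚ) : ℝ) - 1)) B.domain) :
    AlgebraicIndependent ℚ ![B.value, Real.pi] := by
  set K : IntermediateField ℚ ℝ := IntermediateField.adjoin ℚ ({B.value, Real.pi} : Set ℝ)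
    with hK
  have hBK : B.value ∈ K := IntermediateField.subset_adjoin ℚ _ (by simp)
  have hπK : Real.pi ∈ K := IntermediateField.subset_adjoin ℚ _ (by simp)
  refine soloInformed_algebraicIndependent_pair_transfer
    algebraicIndependent_real_pi_gamma_one_third ⟨1, one_pos, by simpa using hπK⟩
    ⟨18, by norm_num, ?_⟩
  rw [soloInformed_gamma_third_pow_eighteen B hBd hBi]
  exact mul_mem (mul_mem (by exact_mod_cast (div_mem (K.natCast_mem 256) (K.natCast_mem 27)))
    (pow_mem hπK 6)) (pow_mem hBK 6)

/-- **Theorem IX″ at `a = ⅓`, unconditional**: the Kontsevich–Zagier conjecture holds on the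
equianharmonic sector `ℤ[⟦β(⅓,½)⟧, ⟦β(⅚,½)⟧, ⟦π⟧]` (derived relation
`⟦β(⅓,½)⟧⟦β(⅚,½)⟧ = 3⟦π⟧`). [Kontsevich–Zagier 2001, §1.2, Conjecture 1 — this sector] -/
theorem soloInformed_kzp_on_eulerSector_third (B B' : IntegralRep 1)
    (hBd : B.domain = {t | t 0 ∈ Set.Ioo (0:ℝ) 1})
    (hBi : Set.EqOn B.integrand
      (fun t => (t 0) ^ (((1 / 3 : ℚ) : ℝ) - 1) * (1 - t 0) ^ (((1 / 2 : ℚ) : ℝ) - 1)) B.domain)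
    (hB'd : B'.domain = {t | t 0 ∈ Set.Ioo (0:ℝ) 1})
    (hB'i : Set.EqOn B'.integrand
      (fun t => (t 0) ^ (((5 / 6 : ℚ) : ℝ) - 1) * (1 - t 0) ^ (((1 / 2 : ℚ) : ℝ) - 1)) B'.domain)
    {n m : ℕ} (r : IntegralRep n) (r' : IntegralRep m)
    (hr : toFormalPeriod (of r) ∈ Algebra.adjoin ℤ
      ({toFormalPeriod (of B), toFormalPeriod (of B'), toFormalPeriod (of KZ.piRep)} :
        Set FormalPeriodRing))
    (hr' : toFormalPeriod (of r') ∈ Algebra.adjoin ℤ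
      ({toFormalPeriod (of B), toFormalPeriod (of B'), toFormalPeriod (of KZ.piRep)} :
        Set FormalPeriodRing))
    (hv : r.value = r'.value) : Equivalent r r' := by
  have hp : (0 : ℕ) < 1 := by norm_num
  have hq : (0 : ℕ) < 3 := by norm_num
  refine soloInformed_kzp_on_eulerSector 1 3 B B' hp hq hBd (fun t ht => ?_) hB'd
    (fun t ht => ?_) (soloInformed_algebraicIndependent_betaThirdHalf_pi B hBd hBi)
    r r' hr hr' hv
  · rw [hBi ht]; norm_num
  · rw [hB'i ht]; norm_num

/-! ### `a = ⅙` -/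

/-- **`Γ(⅓)⁹ = (16/27) π³ B(⅙,½)³`** for a representation pinned as `β(⅙,½)`
(`B(⅙,½) = Γ(⅙)√π/Γ(⅔)`, duplication `Γ(⅙)Γ(⅔) = 2^{2/3}√π Γ(⅓)`, reflection).
[Legendre; Andrews–Askey–Roy 1999, Thm. 1.5.1] -/
theorem soloInformed_gamma_third_pow_nine (B : IntegralRep 1)
    (hBd : B.domain = {t | t 0 ∈ Set.Ioo (0:ℝ) 1})
    (hBi : Set.EqOn B.integrand
      (fun t => (t 0) ^ (((1 / 6 : ℚ) : ℝ) - 1) * (1 - t 0) ^ (((1 / 2 : ℚ) : ℝ) - 1)) B.domain) :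
    Real.Gamma (1 / 3) ^ 9 = 16 / 27 * Real.pi ^ 3 * B.value ^ 3 := by
  set g := Real.Gamma (1 / 3) with hg
  set c : ℝ := (2 : ℝ) ^ ((2 : ℝ) / 3) with hc
  have hG23 : Real.Gamma (2 / 3) ≠ 0 := (Real.Gamma_pos_of_pos (by norm_num)).ne'
  have hπ0 : Real.pi ≠ 0 := Real.pi_pos.ne'
  have hc3 : c ^ 3 = 4 := by
    rw [hc, ← Real.rpow_natCast, ← Real.rpow_mul (by norm_num)]
    norm_num
  have hsqπ : Real.sqrt Real.pi * Real.sqrt Real.pi = Real.pi :=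
    Real.mul_self_sqrt Real.pi_pos.le
  -- value
  have hv := soloInformed_value_betaRep (1 / 6) (1 / 2) (by norm_num) (by norm_num) B hBd hBi
  have hv' : B.value = Real.Gamma (1 / 6) * Real.sqrt Real.pi / Real.Gamma (2 / 3) := by
    rw [hv, ← Real.Gamma_one_half_eq]
    push_cast
    norm_num
  have hBv : B.value * Real.Gamma (2 / 3) = Real.Gamma (1 / 6) * Real.sqrt Real.pi := by
    rw [hv']
    exact div_mul_cancel₀ _ hG23
  -- duplication at 1/6 : Γ(1/6) Γ(2/3) = Γ(1/3) c √π
  have e1 : Real.Gamma (1 / 6) * Real.Gamma (2 / 3) = g * c * Real.sqrt Real.pi := by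
    have e := Real.Gamma_mul_Gamma_add_half (1 / 6 : ℝ)
    rw [show (1 : ℝ) / 6 + 1 / 2 = 2 / 3 by norm_num, show (2 : ℝ) * (1 / 6) = 1 / 3 by norm_num,
      show (1 : ℝ) - 1 / 3 = 2 / 3 by norm_num] at e
    rw [hg, hc]
    exact e
  have hsq : (g * Real.Gamma (2 / 3)) ^ 2 = 4 * Real.pi ^ 2 / 3 := by
    rw [hg]
    exact soloInformed_sq_gamma_third_mul_gamma_two_thirds
  -- B Γ(2/3)² = g c π
  have hB2 : B.value * Real.Gamma (2 / 3) ^ 2 = g * c * Real.pi := by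
    linear_combination Real.Gamma (2 / 3) * hBv + Real.sqrt Real.pi * e1 + (g * c) * hsqπ
  -- multiply by g²: B (4π²/3) = g³ c π
  have hB3 : B.value * (4 * Real.pi ^ 2 / 3) = g ^ 3 * c * Real.pi := by
    rw [← hsq]
    linear_combination g ^ 2 * hB2
  have hB4 : B.value * (4 * Real.pi) = 3 * c * g ^ 3 := by
    apply mul_right_cancel₀ hπ0
    linear_combination 3 * hB3
  have e : (B.value * (4 * Real.pi)) ^ 3 = (3 * c * g ^ 3) ^ 3 := by rw [hB4]
  rw [show (3 * c * g ^ 3) ^ 3 = 27 * c ^ 3 * g ^ 9 by ring, hc3] at e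
  linear_combination (-1 / 108 : ℝ) * e

/-- **`B(⅙,½)` and `π` are algebraically independent over `ℚ`** (`Γ(⅓)⁹ ∈ ℚ(B, π)`).
[Chudnovsky 1984, Ch. 7, Cor. 2.3] -/
theorem soloInformed_algebraicIndependent_betaSixthHalf_pi (B : IntegralRep 1)
    (hBd : B.domain = {t | t 0 ∈ Set.Ioo (0:ℝ) 1})
    (hBi : Set.EqOn B.integrand
      (fun t => (t 0) ^ (((1 / 6 : ℚ) : ℝ) - 1) * (1 - t 0) ^ (((1 / 2 : ℚ) : ℝ) - 1)) B.domain) :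
    AlgebraicIndependent ℚ ![B.value, Real.pi] := by
  set K : IntermediateField ℚ ℝ := IntermediateField.adjoin ℚ ({B.value, Real.pi} : Set ℝ)
    with hK
  have hBK : B.value ∈ K := IntermediateField.subset_adjoin ℚ _ (by simp)
  have hπK : Real.pi ∈ K := IntermediateField.subset_adjoin ℚ _ (by simp)
  refine soloInformed_algebraicIndependent_pair_transfer
    algebraicIndependent_real_pi_gamma_one_third ⟨1, one_pos, by simpa using hπK⟩
    ⟨9, by norm_num, ?_⟩
  rw [soloInformed_gamma_third_pow_nine B hBd hBi]
  exact mul_mem (mul_mem (by exact_mod_cast (div_mem (K.natCast_mem 16) (K.natCast_mem 27)))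
    (pow_mem hπK 3)) (pow_mem hBK 3)

/-- **Theorem IX″ at `a = ⅙`, unconditional**: the Kontsevich–Zagier conjecture holds on the sector
`ℤ[⟦β(⅙,½)⟧, ⟦β(⅔,½)⟧, ⟦π⟧]` (derived relation `⟦β(⅙,½)⟧⟦β(⅔,½)⟧ = 6⟦π⟧`).
[Kontsevich–Zagier 2001, §1.2, Conjecture 1 — this sector] -/
theorem soloInformed_kzp_on_eulerSector_sixth (B B' : IntegralRep 1)
    (hBd : B.domain = {t | t 0 ∈ Set.Ioo (0:ℝ) 1})
    (hBi : Set.EqOn B.integrand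
      (fun t => (t 0) ^ (((1 / 6 : ℚ) : ℝ) - 1) * (1 - t 0) ^ (((1 / 2 : ℚ) : ℝ) - 1)) B.domain)
    (hB'd : B'.domain = {t | t 0 ∈ Set.Ioo (0:ℝ) 1})
    (hB'i : Set.EqOn B'.integrand
      (fun t => (t 0) ^ (((2 / 3 : ℚ) : ℝ) - 1) * (1 - t 0) ^ (((1 / 2 : ℚ) : ℝ) - 1)) B'.domain)
    {n m : ℕ} (r : IntegralRep n) (r' : IntegralRep m)
    (hr : toFormalPeriod (of r) ∈ Algebra.adjoin ℤ
      ({toFormalPeriod (of B), toFormalPeriod (of B'), toFormalPeriod (of KZ.piRep)} :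
        Set FormalPeriodRing))
    (hr' : toFormalPeriod (of r') ∈ Algebra.adjoin ℤ
      ({toFormalPeriod (of B), toFormalPeriod (of B'), toFormalPeriod (of KZ.piRep)} :
        Set FormalPeriodRing))
    (hv : r.value = r'.value) : Equivalent r r' := by
  have hp : (0 : ℕ) < 1 := by norm_num
  have hq : (0 : ℕ) < 6 := by norm_num
  refine soloInformed_kzp_on_eulerSector 1 6 B B' hp hq hBd (fun t ht => ?_) hB'd
    (fun t ht => ?_) (soloInformed_algebraicIndependent_betaSixthHalf_pi B hBd hBi)
    r r' hr hr' hv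
  · rw [hBi ht]; norm_num
  · rw [hB'i ht]; norm_num

end Summit.KontsevichZagierPeriods.KontsevichZagierPeriods.Theorems

end
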